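import Summits.AtomisticToContinuum.HydrodynamicLimit.Theorems.OneFlightGossipEngineEquilibriumStressVarianceDecayCore
import Summits.AtomisticToContinuum.HydrodynamicLimit.Theses.OneFlightGossipEngine
import Summits.AtomisticToContinuum.HydrodynamicLimit.Theses.FluxGibbsianityLdDrude

/-!
# `FastObservableMeanErgodic → EquilibriumStressVarianceDecay` (file 5/5 for
# `OneFlightGossipEngine.EquilibriumStressVarianceDecay`, stmt-AtomisticToContinuum-9531)

The equilibrium kinetic shear-stress rung C3 of route `OneFlightGossipEngine`
(`EquilibriumStressVarianceDecay`, stmt-9531: `lim_{τ→∞} limsup_N (N+1)·E_{G_N}[Ȳ_τ²] = 0` for the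
window-averaged per-particle kinetic shear stress `φ(x)v₀v₁` under the homogeneous Gibbs law at fixed
small reduced density) FOLLOWS from the shared `L²` milestone `FastObservableMeanErgodic` of route
`FluxGibbsianityLdDrude` (stmt-AtomisticToContinuum-10952: for bounded continuous `g ⊥ span(1,v,|v|²)`,
`∀ δ ∃ τ ∃ N₀ ∀ N ≥ N₀ ∀ Φ`, window variance `≤ δ(N+1)`):
`equilibriumStressVarianceDecay_of_fastObservableMeanErgodic`.

Proof: `EquilibriumStressVarianceDecayC3.core_bound` (`…Core`) with the milestone applied to the
truncated germ `t = w₀w₁/(1+|w|²/A)` (`…Truncation`: continuous, `|t| ≤ A/2`, `t ⊥ span(1,v,|v|²)`), then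
the choice
of constants: `A` (remainder `≤ ε/3`), `δ = ε/(12θ₀²)` (hence `τ₀, N₀` from the milestone), `k₀` blocks
(`4θ₀²K²E|w|⁴/k ≤ ε/3`); for `τ ≥ (k₀+1)τ₀` and `N ≥ N₀` the functional is `≤ ε`, so its `limsup_N` is,
and `Tendsto … atTop (𝓝 0)` follows (`ENNReal.tendsto_nhds_zero`). So item 9531 is REDUCED to item
10952 (both open; 9531 is the `g = w₀w₁` instance of 10952 up to truncation); no dynamics is used beyond
Liouville invariance of `G_N` and the group property of the flow.

Also recorded: `equilibriumStressVariance_apriori`, the unconditional bound `≤ θ₀²K²E_γ|w|⁴` of the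
item's functional for every `N`, `τ > 0`, `σ ≤ 1/2` (critical normalisation).
-/

noncomputable section

namespace Summit.AtomisticToContinuum.HydrodynamicLimit.Theorems

open MeasureTheory ProbabilityTheory Filter Topology Set
open Literature.Analysis.FluidPDE Literature.MathematicalPhysics.KineticTheory
open scoped InnerProductSpace ENNReal
open BoltzmannGreenKuboOrthMomentum BoltzmannGreenKuboForallN EquilibriumStressVarianceDecayC3

/-- **`FastObservableMeanErgodic → EquilibriumStressVarianceDecay`** (stmt-10952 ⟹ stmt-9531): the
N-uniform Cesàro decay of the equilibrium kinetic shear-stress window variance follows from the shared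
`L²` milestone "uniform-in-`N` mean ergodicity of bounded fast one-body observables", by truncating
`w₀w₁` to the bounded odd `w₀w₁/(1+|w|²/A)`, controlling the remainder statically (ceiling + weighted statics) and
upgrading the milestone's `∃ τ` to all larger windows by block sub-convexity. [folklore] -/
theorem equilibriumStressVarianceDecay_of_fastObservableMeanErgodic
    (hF : Summit.AtomisticToContinuum.HydrodynamicLimit.Theses.FluxGibbsianityLdDrude.FastObservableMeanErgodic) :
    Summit.AtomisticToContinuum.HydrodynamicLimit.Theses.OneFlightGossipEngine.EquilibriumStressVarianceDecay := by
  intro a₀ θ₀ ha hθ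
  obtain ⟨σ₀, hσ₀, hmain⟩ := hF a₀ θ₀ 0 ha hθ
  refine ⟨σ₀, hσ₀, fun σ hσ hσlt Φ φ hφ => ?_⟩
  obtain ⟨hprob, hfome⟩ := hmain σ hσ hσlt
  obtain ⟨K, hK0, hK⟩ := exists_forall_abs_le_of_continuous hφ
  rw [ENNReal.tendsto_nhds_zero]
  intro η hη
  -- a real target `ε ≤ η`
  have hmin0 : min η 1 ≠ 0 := (lt_min hη one_pos).ne'
  have hmintop : min η 1 ≠ ⊤ := ne_top_of_le_ne_top ENNReal.one_ne_top (min_le_right _ _)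
  set ε : ℝ := (min η 1).toReal with hε
  have hε0 : 0 < ε := ENNReal.toReal_pos hmin0 hmintop
  have hεη : ENNReal.ofReal ε ≤ η := by
    rw [hε, ENNReal.ofReal_toReal hmintop]; exact min_le_left _ _
  -- Gaussian moments
  set M₄ : ℝ := ∫ w : V3, ‖w‖ ^ 4 ∂stdGaussian V3 with hM₄
  set M₈ : ℝ := ∫ w : V3, ‖w‖ ^ 8 ∂stdGaussian V3 with hM₈
  have hM₄0 : 0 ≤ M₄ := integral_nonneg fun w => by positivity
  have hM₈0 : 0 ≤ M₈ := integral_nonneg fun w => by positivity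
  -- the truncation level `A`
  set A : ℝ := max 1 (3 * θ₀ ^ 2 * K ^ 2 * M₈ / (2 * ε)) with hAdef
  have hA1 : 1 ≤ A := le_max_left _ _
  have hA : 0 < A := one_pos.trans_le hA1
  have hA3 : θ₀ ^ 2 * (2 * K ^ 2 * (M₈ / (2 * A) ^ 2)) ≤ ε / 3 := by
    have h1 : θ₀ ^ 2 * (2 * K ^ 2 * (M₈ / (2 * A) ^ 2)) = (θ₀ ^ 2 * K ^ 2 * M₈ / (2 * A)) * (1 / A) := by
      field_simp
    have h2 : θ₀ ^ 2 * K ^ 2 * M₈ / (2 * A) ≤ ε / 3 := by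
      rw [div_le_iff₀ (by positivity)]
      have : 3 * θ₀ ^ 2 * K ^ 2 * M₈ / (2 * ε) ≤ A := le_max_right _ _
      rw [div_le_iff₀ (by positivity)] at this
      nlinarith
    rw [h1]
    calc θ₀ ^ 2 * K ^ 2 * M₈ / (2 * A) * (1 / A) ≤ ε / 3 * 1 :=
          mul_le_mul h2 (by rw [div_le_one hA]; exact hA1) (by positivity) (by positivity)
      _ = ε / 3 := mul_one _
  -- the accuracy `δ` and FastObservableMeanErgodic for the truncated shear stress
  set δ : ℝ := ε / (12 * θ₀ ^ 2) with hδdef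
  have hδ : 0 < δ := by positivity
  have hδ3 : θ₀ ^ 2 * (4 * δ) = ε / 3 := by rw [hδdef]; field_simp; ring
  obtain ⟨gA, rA, hgA, hrA⟩ := exists_trunc_rem A
  obtain ⟨τ₀, hτ₀, N₀, hN₀⟩ := hfome φ gA hφ (continuous_trunc hA hgA) ⟨A / 2, abs_trunc_le hA hgA⟩
    (fun c₀ c₂ b => trunc_orth hA hgA c₀ c₂ b) δ hδ
  -- the number of blocks
  obtain ⟨k₀, hk₀⟩ := exists_nat_ge (12 * θ₀ ^ 2 * K ^ 2 * M₄ / ε)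
  refine Filter.eventually_atTop.2 ⟨((k₀ : ℝ) + 1) * τ₀, fun τ hτ => ?_⟩
  have hτpos : 0 < τ := (by positivity : (0 : ℝ) < ((k₀ : ℝ) + 1) * τ₀).trans_le hτ
  set k : ℕ := ⌊τ / τ₀⌋₊ with hkdef
  have hk₀k : k₀ + 1 ≤ k := by
    refine Nat.le_floor ?_
    rw [le_div_iff₀ hτ₀]; exact_mod_cast hτ
  have hk1 : 1 ≤ k := le_trans (Nat.le_add_left 1 k₀) hk₀k
  have hkτ : (k : ℝ) * τ₀ ≤ τ := by
    have := Nat.floor_le (div_nonneg hτpos.le hτ₀.le) (a := τ / τ₀)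
    rw [← hkdef] at this
    rwa [le_div_iff₀ hτ₀] at this
  have hτk : τ ≤ ((k : ℝ) + 1) * τ₀ := by
    have := Nat.lt_floor_add_one (τ / τ₀)
    rw [← hkdef, div_lt_iff₀ hτ₀] at this
    exact this.le
  have hk3 : θ₀ ^ 2 * (4 * K ^ 2 * M₄ / (k : ℝ) ^ 2) ≤ ε / 3 := by
    have hkpos : (0 : ℝ) < k := by exact_mod_cast hk1
    have hkk : (12 * θ₀ ^ 2 * K ^ 2 * M₄ / ε) ≤ k := by
      have : (k₀ : ℝ) + 1 ≤ k := by exact_mod_cast hk₀k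
      linarith
    have hsq : (k : ℝ) ≤ (k : ℝ) ^ 2 := by
      have : (1 : ℝ) ≤ k := by exact_mod_cast hk1
      nlinarith
    rw [div_le_iff₀ hε0] at hkk
    calc θ₀ ^ 2 * (4 * K ^ 2 * M₄ / (k : ℝ) ^ 2) ≤ θ₀ ^ 2 * (4 * K ^ 2 * M₄ / k) := by
          gcongr
      _ ≤ ε / 3 := by
          rw [mul_div_assoc', div_le_iff₀ hkpos]
          nlinarith
  -- the `limsup` over `N`
  refine (Filter.limsup_le_of_le (h := Filter.eventually_atTop.2 ⟨N₀, fun N hN => ?_⟩)).trans hεη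
  haveI := hprob N (Φ N)
  have hℓ : 0 < ((N : ℝ) + 1) ^ (-(1 / 3 : ℝ)) := Real.rpow_pos_of_pos (by positivity) _
  have hwin := hN₀ N hN (Φ N)
  have hcastN : ((N + 1 : ℕ) : ℝ) = (N : ℝ) + 1 := by push_cast; ring
  rw [hcastN] at hwin
  have core := core_bound (N := N) ha.le hθ (Φ N) hφ hK hA hgA hrA hδ.le (h₀ := τ₀ * ((N : ℝ) + 1) ^ (-(1 / 3 : ℝ)))
    (h := τ * ((N : ℝ) + 1) ^ (-(1 / 3 : ℝ))) (by positivity) hk1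
    (by rw [← mul_assoc]; exact mul_le_mul_of_nonneg_right hkτ hℓ.le)
    (by rw [← mul_assoc]; exact mul_le_mul_of_nonneg_right hτk hℓ.le) hwin
  refine core.trans (ENNReal.ofReal_le_ofReal ?_)
  calc θ₀ ^ 2 * (4 * δ + 4 * K ^ 2 * M₄ / (k : ℝ) ^ 2 + 2 * K ^ 2 * (M₈ / (2 * A) ^ 2))
      = θ₀ ^ 2 * (4 * δ) + θ₀ ^ 2 * (4 * K ^ 2 * M₄ / (k : ℝ) ^ 2) + θ₀ ^ 2 * (2 * K ^ 2 * (M₈ / (2 * A) ^ 2)) := by ring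
    _ ≤ ε / 3 + ε / 3 + ε / 3 := add_le_add (add_le_add hδ3.le hk3) hA3
    _ = ε := by ring

/-- **The a-priori bound in the item's own frame**: for every `a₀, θ₀ > 0`, every `0 < σ ≤ 1/2`, every
family of flows, every continuous `φ` with `|φ| ≤ K`, every `τ > 0` and EVERY `N`, the quantity whose
`limsup_N` the item sends to `0` as `τ → ∞` is `≤ θ₀² K² E_γ|w|⁴ < ∞`. [folklore] -/
theorem equilibriumStressVariance_apriori {a₀ θ₀ σ : ℝ} (ha : 0 < a₀) (hθ : 0 < θ₀) (hσ : σ ≤ 1 / 2)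
    {N : ℕ} (Φ : HardSphereFlow (Torus.geometry (Fin 3)) (hsDiameter σ N) (N + 1))
    {φ : T3 → ℝ} (hφ : Continuous φ) {K : ℝ} (hK : ∀ x, |φ x| ≤ K) {τ : ℝ} (hτ : 0 < τ) :
    ((N : ℝ≥0∞) + 1) * ∫⁻ z, ENNReal.ofReal ((((N : ℝ) + 1)⁻¹ * ∑ i : Fin (N + 1),
        ((τ * ((N : ℝ) + 1) ^ (-(1 / 3 : ℝ)))⁻¹ * ∫ r in (0 : ℝ)..(τ * ((N : ℝ) + 1) ^ (-(1 / 3 : ℝ))),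
          φ ((Φ.flow r z i).1) * ((Φ.flow r z i).2 0 * (Φ.flow r z i).2 1))) ^ 2)
        ∂(localGibbsLaw σ (fun _ => a₀) (fun _ => 0) (fun _ => θ₀) N Φ) ≤
      ENNReal.ofReal (θ₀ ^ 2 * (K ^ 2 * ∫ w : V3, ‖w‖ ^ 4 ∂stdGaussian V3)) := by
  haveI : IsProbabilityMeasure (localGibbsLaw σ (fun _ => a₀) (fun _ => (0 : V3)) (fun _ => θ₀) N Φ) :=
    isProbabilityMeasure_localGibbsLaw continuous_const continuous_const continuous_const
      (fun _ => ha) (fun _ => hθ) hσ N Φ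
  have hℓ : 0 < ((N : ℝ) + 1) ^ (-(1 / 3 : ℝ)) := Real.rpow_pos_of_pos (by positivity) _
  exact apriori_bound ha.le hθ Φ hφ hK (mul_pos hτ hℓ)

end Summit.AtomisticToContinuum.HydrodynamicLimit.Theorems

end
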